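import Mathlib
import Summits.NavierStokesRegularity.NavierStokesRegularity.Theorems.EulerZoomLiouvillePowerGaugeEulerLiouvilleWeakCommutingVorticity
import Summits.NavierStokesRegularity.NavierStokesRegularity.Theorems.EulerZoomLiouvillePowerGaugeEulerLiouvilleSelfSimilarPastSubExtremal
import Summits.NavierStokesRegularity.NavierStokesRegularity.Theorems.EulerZoomLiouvillePowerGaugeEulerLiouvilleSelfSimilarProfileEquation
import Summits.NavierStokesRegularity.NavierStokesRegularity.Theorems.EulerZoomLiouvillePowerGaugeEulerLiouvilleSelfSimilarGauges
import Summits.NavierStokesRegularity.NavierStokesRegularity.Theorems.EulerZoomLiouvillePowerGaugeEulerLiouvilleBirthDefs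
import HarnessLib

/-!
# Crux `EulerZoomLiouville.PowerGaugeEulerLiouville` (stmt-NavierStokesRegularity-19832), stub `stub_selfSimilarWeakRest`:
# MEMBER LEVEL — weakly commuting exactly self-similar members of the WEAK class are trivial

Helper file (theorems only; `--supports stmt-NavierStokesRegularity-19832`; def-free).  Hand leafhand-ns-eulerzoomliouville-10 g1; member-level
wrapper of `WeakCommuting.ae_eq_zero_of_curlTested` (`…WeakCommutingVorticity`).

Crux hypotheses verbatim (`InClass`: suitable weak Euler pair on the slab, weak spatial gradient `H`, the three power gauges) + exact self-similarity
about the origin (`IsExactlySelfSimilar ρ u p V P`, window rate `γ = 1/(2+ρ)`, any `0 < ρ`), and at PROFILE level, in the phrasing of the skeleton's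
weak-curl binders (`IsWeakConfinedCurl`): a whole-space weak gradient `G` of `V` with `‖G‖²` integrable on the closed unit ball, and the CURL-TESTED
WEAK PROFILE IDENTITY WITHOUT LAMB TERM (the distributional profile equation `ProfileEquation.weak_profile_equation` tested with the divergence-free
curl pairs `η_ψ = (∂ᵥψ)w − (∂_wψ)v`, in which the velocity-tested weak curl of the Lamb vector `∫⟪V,(V·∇)η_ψ⟫` vanishes — the weak form of
«velocity and vorticity commute», containing every weak generalized-Beltrami profile).  CONCLUSION: `u = 0` a.e. on `(−∞,0) × ℝ³`.
Chain: `profile_isWeaklyDivFree` (tree) + `profile_energy_growth_of_gaugeA` (tree, `m = 1 − 2ρ < 3`) ⇒ `WeakCommuting.ae_eq_zero_of_curlTested`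
⇒ `V = 0` a.e. ⇒ `Past.ae_eq_zero_of_profile_ae_eq_zero` (tree).

* `Loc.selfSimilar_ae_eq_zero_of_weaklyCommuting_profile` — hypotheses unbundled;
* `Birth.selfSimilarWeak_of_weaklyCommuting` — binder language (`InClass`, `IsExactlySelfSimilar`), no `C²` assumption: a closed sub-stratum inside
  the territory of `stub_selfSimilarWeakRest` (and of `stub_selfSimilarC2Needle`).

WHAT THIS IS NOT: not a proof of either stub or of the crux; nothing about Navier–Stokes. [folklore]
-/

noncomputable section

-- flat `Theorems/<Route><Decl>…` files of one crux share the namespace of the crux (tree convention)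
set_option linter.dupNamespace false

open MeasureTheory Set Filter Topology Metric Function TopologicalSpace
open scoped RealInnerProductSpace NNReal ENNReal ContDiff

namespace Summit.NavierStokesRegularity.NavierStokesRegularity.Theorems.PowerGaugeEulerLiouville

open Literature.Analysis Literature.Analysis.FunctionSpaces Literature.Analysis.FluidPDE

/-- **WEAKLY COMMUTING EXACTLY SELF-SIMILAR MEMBERS OF THE WEAK CLASS ARE TRIVIAL** (every `0 < ρ`; see the module docstring). [folklore] -/
theorem Loc.selfSimilar_ae_eq_zero_of_weaklyCommuting_profile {ρ : ℝ} (hρ : 0 < ρ)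
    {u : ℝ → EuclideanSpace ℝ (Fin 3) → EuclideanSpace ℝ (Fin 3)} {p : ℝ → EuclideanSpace ℝ (Fin 3) → ℝ}
    {H : ℝ → EuclideanSpace ℝ (Fin 3) → EuclideanSpace ℝ (Fin 3) →L[ℝ] EuclideanSpace ℝ (Fin 3)} {c : ℝ≥0}
    (hsw : IsSuitableWeakSolutionOn (slab (EuclideanSpace ℝ (Fin 3)) (Iio 0) isOpen_Iio) 0 0 u p)
    (hH : HasWeakSpatialGradientOn (slab (EuclideanSpace ℝ (Fin 3)) (Iio 0) isOpen_Iio) u H)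
    (hgauge : ∀ a : ℝ, 0 < a →
      ENNReal.ofReal (a ^ (2 * ρ)) * cknA a (0 : ℝ × EuclideanSpace ℝ (Fin 3)) u +
          ENNReal.ofReal (a ^ ρ) * cknE a (0 : ℝ × EuclideanSpace ℝ (Fin 3)) H +
        ENNReal.ofReal (a ^ (2 * ρ)) * cknD a (0 : ℝ × EuclideanSpace ℝ (Fin 3)) p ≤ (c : ℝ≥0∞))
    {V : EuclideanSpace ℝ (Fin 3) → EuclideanSpace ℝ (Fin 3)}
    (hu : ∀ τ : ℝ, τ < 0 → u τ = selfSimilarCollapse (1 / (2 + ρ)) 0 V τ)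
    {G : EuclideanSpace ℝ (Fin 3) → EuclideanSpace ℝ (Fin 3) →L[ℝ] EuclideanSpace ℝ (Fin 3)}
    (hG : HasWeakGradient V G)
    (hG2 : IntegrableOn (fun y => ‖G y‖ ^ 2) (closedBall (0 : EuclideanSpace ℝ (Fin 3)) 1) volume)
    (hCT : ∀ ψ : EuclideanSpace ℝ (Fin 3) → ℝ, ContDiff ℝ ∞ ψ → HasCompactSupport ψ → ∀ v w : EuclideanSpace ℝ (Fin 3),
      (1 / (2 + ρ)) * (∫ y, ⟪V y, fderiv ℝ (fun z : EuclideanSpace ℝ (Fin 3) => fderiv ℝ ψ z v • w - fderiv ℝ ψ z w • v) y y⟫) +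
        (4 * (1 / (2 + ρ)) - 1) * (∫ y, ⟪V y, fderiv ℝ ψ y v • w - fderiv ℝ ψ y w • v⟫) = 0) :
    uncurry u =ᵐ[volume.restrict (Iio (0 : ℝ) ×ˢ (univ : Set (EuclideanSpace ℝ (Fin 3))))] 0 := by
  have h2ρ : (0 : ℝ) < 2 + ρ := by linarith
  have hγ : (0 : ℝ) < 1 / (2 + ρ) := one_div_pos.2 h2ρ
  have hγ1 : 1 / (2 + ρ) < 2 / 3 := by
    rw [div_lt_div_iff₀ h2ρ (by norm_num : (0:ℝ) < 3)]
    linarith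
  -- profile data
  have hVli : LocallyIntegrable V volume := locallyIntegrableOn_univ.1 (by
    simpa only [Opens.coe_top] using hG.locallyIntegrableOn)
  have hdiv : IsWeaklyDivFree V := ProfileEquation.profile_isWeaklyDivFree hsw.distributional hu hVli
  have hA : ∀ a : ℝ, 0 < a → ENNReal.ofReal (a ^ (2 * ρ)) *
      cknA a (0 : ℝ × EuclideanSpace ℝ (Fin 3)) u ≤ (c : ℝ≥0∞) :=
    fun a ha => le_trans (le_trans le_self_add le_self_add) (hgauge a ha)
  have hgrowth0 := profile_energy_growth_of_gaugeA hρ hu hA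
  have hgrowth : ∀ r : ℝ, (0 : ℝ) < r → 0 < r →
      ∫⁻ x in ball (0 : EuclideanSpace ℝ (Fin 3)) r, ‖V x‖ₑ ^ 2 ≤ ENNReal.ofReal ((c : ℝ) * r ^ (1 - 2 * ρ)) := by
    intro r _ hr
    refine (hgrowth0 r hr).trans_eq ?_
    rw [ENNReal.ofReal_mul c.coe_nonneg, ENNReal.ofReal_coe_nnreal]
  -- the weak-class kill
  have hV0 : V =ᵐ[volume] 0 :=
    WeakCommuting.ae_eq_zero_of_curlTested hG hdiv hγ hγ1 hCT hG2 (m := 1 - 2 * ρ) (by linarith) hgrowth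
  -- an a.e.-vanishing profile gives a trivial member
  have hu' : ∀ τ : ℝ, τ < 0 → u τ = fun x => selfSimilarCollapse (1 / (2 + ρ)) 0 V τ (x - 0) :=
    fun τ hτ => by rw [hu τ hτ]; funext x; rw [sub_zero]
  exact Past.ae_eq_zero_of_profile_ae_eq_zero (T := 0) (T₁ := 0) (x₀ := 0) hρ.le le_rfl hsw hH hgauge hu' hV0

/-- **THE WEAKLY COMMUTING SUB-STRATUM OF THE WEAK SELF-SIMILAR RESIDUE IS CLOSED** (binder language of the skeleton of record, every `0 < ρ`,
no `C²` hypothesis): a class member, exactly self-similar about the origin, whose velocity profile has a whole-space weak gradient square-integrable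
on the unit ball and satisfies the curl-tested weak profile identity without Lamb term at the class rate `γ = 1/(2+ρ)`, is trivial. [folklore] -/
theorem Birth.selfSimilarWeak_of_weaklyCommuting :
    ∀ ρ : ℝ, 0 < ρ →
      ∀ (u : ℝ → EuclideanSpace ℝ (Fin 3) → EuclideanSpace ℝ (Fin 3)) (p : ℝ → EuclideanSpace ℝ (Fin 3) → ℝ)
        (H : ℝ → EuclideanSpace ℝ (Fin 3) → EuclideanSpace ℝ (Fin 3) →L[ℝ] EuclideanSpace ℝ (Fin 3)) (c : ℝ≥0)
        (V : EuclideanSpace ℝ (Fin 3) → EuclideanSpace ℝ (Fin 3)) (P : EuclideanSpace ℝ (Fin 3) → ℝ),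
        Birth.InClass ρ u p H c → Birth.IsExactlySelfSimilar ρ u p V P →
          (∃ G : EuclideanSpace ℝ (Fin 3) → EuclideanSpace ℝ (Fin 3) →L[ℝ] EuclideanSpace ℝ (Fin 3),
            HasWeakGradient V G ∧
              IntegrableOn (fun y => ‖G y‖ ^ 2) (closedBall (0 : EuclideanSpace ℝ (Fin 3)) 1) volume ∧
              ∀ ψ : EuclideanSpace ℝ (Fin 3) → ℝ, ContDiff ℝ ∞ ψ → HasCompactSupport ψ → ∀ v w : EuclideanSpace ℝ (Fin 3),
                (1 / (2 + ρ)) *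
                    (∫ y, ⟪V y, fderiv ℝ (fun z : EuclideanSpace ℝ (Fin 3) => fderiv ℝ ψ z v • w - fderiv ℝ ψ z w • v) y y⟫) +
                  (4 * (1 / (2 + ρ)) - 1) * (∫ y, ⟪V y, fderiv ℝ ψ y v • w - fderiv ℝ ψ y w • v⟫) = 0) →
          uncurry u =ᵐ[volume.restrict (Iio (0 : ℝ) ×ˢ (univ : Set (EuclideanSpace ℝ (Fin 3))))] 0 := by
  intro ρ hρ u p H c V P hcl hss hW
  obtain ⟨hsw, hH, hgauge⟩ := hcl
  obtain ⟨G, hG, hG2, hCT⟩ := hW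
  exact Loc.selfSimilar_ae_eq_zero_of_weaklyCommuting_profile hρ hsw hH hgauge hss.1 hG hG2 hCT

end Summit.NavierStokesRegularity.NavierStokesRegularity.Theorems.PowerGaugeEulerLiouville

end
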